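import Mathlib
import Summits.CriticalPhenomena.SAWScalingLimit.Theorems.SAWRestrictionRigidityAxiomsOfLimitKernelClauseAEUnique
import Literature.Probability.RandomPlanarGeometry.CurveClassStopAtMeasurable
import HarnessLib

/-!
# A.e. uniqueness of the Markov disintegration kernel at one closed set (a.e.-measurable form)

Crux `AxiomsOfLimit` (stmt-CriticalPhenomena-1370), line `registered`, stub
`stub_markovKernelAEUnique_aem` (lead c5, wave 2). Theorems only.

This is the variant of `stub_markovKernelAEUnique` in which the evaluations
`γ ↦ Qᵢ (γ.stopAt F) T` of the two disintegration kernels are only assumed to agree `μ`-a.e. with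
a measurable function of the past `γ.stopAt F` (instead of `p ↦ Qᵢ p T` being measurable).

Proof: fix a measurable `T` and measurable versions `φ₁, φ₂` of the two evaluations. For every
measurable `S` both `∫⁻ γ in stopAt F ⁻¹' S, φᵢ (γ.stopAt F) ∂μ` equal
`μ (stopAt F ⁻¹' S ∩ startFrom F ⁻¹' T)`, so after pushing forward to `ρ := μ.map (stopAt F)`
(`setLIntegral_map`) the functions `φ₁, φ₂` have the same integral on every measurable set, hence
`φ₁ =ᵐ[ρ] φ₂` (`ae_eq_of_forall_setLIntegral_eq_of_sigmaFinite`); pulling back along `stopAt F`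
(`ae_of_ae_map`) gives `Q₁ (γ.stopAt F) T = Q₂ (γ.stopAt F) T` for `μ`-a.e. `γ`. The total masses
are a.e. finite since `∫⁻ γ, Q₁ (γ.stopAt F) univ ∂μ = μ univ < ∞`. The generic lemma
`AEUnique.ae_eq_of_forall_ae_apply_eq` (setwise a.e. agreement on the countably generated Borel
σ-algebra of `CurveClass ℂ` implies a.e. equality of measures) concludes.

References: O. Kallenberg, *Foundations of Modern Probability* (3rd ed., 2021), Thm. 8.5
(uniqueness of regular conditional distributions). All [folklore].
-/

noncomputable section

open MeasureTheory Set
open scoped ENNReal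

namespace Summit.CriticalPhenomena.SAWScalingLimit.Theorems.AxiomsOfLimitKernelClause

open Literature.Probability.RandomPlanarGeometry

namespace AEUniqueAEM

/-- **Integral of an a.e. version along a measurable map.** If `h γ = φ (g γ)` for `μ`-a.e. `γ`
with `φ` and `g` measurable, then for measurable `S`,
`∫⁻ p in S, φ p ∂(μ.map g) = ∫⁻ γ in g ⁻¹' S, h γ ∂μ`. [folklore] -/
theorem setLIntegral_map_eq_of_ae_eq {Ω : Type*} [MeasurableSpace Ω] {μ : Measure Ω}
    {g : Ω → Ω} (hg : Measurable g) {φ : Ω → ℝ≥0∞} (hφ : Measurable φ) {h : Ω → ℝ≥0∞}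
    (hae : ∀ᵐ γ ∂μ, h γ = φ (g γ)) {S : Set Ω} (hS : MeasurableSet S) :
    ∫⁻ p in S, φ p ∂(μ.map g) = ∫⁻ γ in g ⁻¹' S, h γ ∂μ := by
  rw [setLIntegral_map hS hφ hg]
  refine lintegral_congr_ae (ae_restrict_of_ae ?_)
  filter_upwards [hae] with γ hγ using hγ.symm

/-- **A.e. versions of two disintegrations of the same measure agree a.e.** If `h₁ γ = φ₁ (g γ)`
and `h₂ γ = φ₂ (g γ)` a.e. with `φ₁, φ₂, g` measurable, and `h₁, h₂` have the same integral over
every `g ⁻¹' S` (`S` measurable) under the finite measure `μ`, then `h₁ = h₂` a.e. [folklore] -/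
theorem ae_eq_of_versions {Ω : Type*} [MeasurableSpace Ω] {μ : Measure Ω} [IsFiniteMeasure μ]
    {g : Ω → Ω} (hg : Measurable g) {φ₁ φ₂ h₁ h₂ : Ω → ℝ≥0∞} (hφ₁ : Measurable φ₁)
    (hφ₂ : Measurable φ₂) (hae₁ : ∀ᵐ γ ∂μ, h₁ γ = φ₁ (g γ)) (hae₂ : ∀ᵐ γ ∂μ, h₂ γ = φ₂ (g γ))
    (hint : ∀ S : Set Ω, MeasurableSet S →
      ∫⁻ γ in g ⁻¹' S, h₁ γ ∂μ = ∫⁻ γ in g ⁻¹' S, h₂ γ ∂μ) :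
    ∀ᵐ γ ∂μ, h₁ γ = h₂ γ := by
  have hρ : φ₁ =ᵐ[μ.map g] φ₂ := by
    refine ae_eq_of_forall_setLIntegral_eq_of_sigmaFinite hφ₁ hφ₂ fun S hS _ => ?_
    rw [setLIntegral_map_eq_of_ae_eq hg hφ₁ hae₁ hS, setLIntegral_map_eq_of_ae_eq hg hφ₂ hae₂ hS]
    exact hint S hS
  have hμ : ∀ᵐ γ ∂μ, φ₁ (g γ) = φ₂ (g γ) := ae_of_ae_map hg.aemeasurable hρ
  filter_upwards [hae₁, hae₂, hμ] with γ h1 h2 h12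
  rw [h1, h2, h12]

/-- **An a.e. version with finite integral is a.e. finite.** If `h γ = φ (g γ)` a.e. with `φ, g`
measurable and `∫⁻ γ, h γ ∂μ ≠ ∞`, then `h γ < ∞` for a.e. `γ`. [folklore] -/
theorem ae_lt_top_of_version {Ω : Type*} [MeasurableSpace Ω] {μ : Measure Ω}
    {g : Ω → Ω} (hg : Measurable g) {φ h : Ω → ℝ≥0∞} (hφ : Measurable φ)
    (hae : ∀ᵐ γ ∂μ, h γ = φ (g γ)) (hint : ∫⁻ γ, h γ ∂μ ≠ ∞) :
    ∀ᵐ γ ∂μ, h γ < ∞ := by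
  have hint' : ∫⁻ γ, φ (g γ) ∂μ ≠ ∞ := by
    rwa [← lintegral_congr_ae hae]
  filter_upwards [ae_lt_top (hφ.comp hg) hint', hae] with γ hγ hγ'
  rw [hγ']
  exact hγ

end AEUniqueAEM

/-- **A.e. uniqueness of the Markov disintegration kernel (a.e.-measurable evaluations).** Let
`μ` be a finite measure on curve classes, `F ⊆ ℂ` closed, and
`Q₁, Q₂ : CurveClass ℂ → Measure (CurveClass ℂ)` two maps whose evaluations
`γ ↦ Qᵢ (γ.stopAt F) T` (`T` measurable) agree `μ`-a.e. with measurable functions of `γ.stopAt F`,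
both disintegrating `μ` along the past at `F`:
`μ (stopAt F ⁻¹' S ∩ startFrom F ⁻¹' T) = ∫⁻ γ in stopAt F ⁻¹' S, Qᵢ (γ.stopAt F) T ∂μ` for all
measurable `S, T`. Then `Q₁ (γ.stopAt F) = Q₂ (γ.stopAt F)` for `μ`-a.e. `γ` (Kallenberg,
*Foundations of Modern Probability*, uniqueness of regular conditional distributions).
[folklore] -/
theorem stub_markovKernelAEUnique_aem : ∀ (μ : MeasureTheory.Measure (Literature.Probability.RandomPlanarGeometry.CurveClass ℂ)) [MeasureTheory.IsFiniteMeasure μ] (F : Set ℂ), IsClosed F → ∀ (Q₁ Q₂ : Literature.Probability.RandomPlanarGeometry.CurveClass ℂ → MeasureTheory.Measure (Literature.Probability.RandomPlanarGeometry.CurveClass ℂ)), (∀ T : Set (Literature.Probability.RandomPlanarGeometry.CurveClass ℂ), MeasurableSet T → ∃ φ : Literature.Probability.RandomPlanarGeometry.CurveClass ℂ → ENNReal, Measurable φ ∧ Filter.Eventually (fun γ : Literature.Probability.RandomPlanarGeometry.CurveClass ℂ => Q₁ (γ.stopAt F) T = φ (γ.stopAt F)) (MeasureTheory.ae μ)) →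 (∀ T : Set (Literature.Probability.RandomPlanarGeometry.CurveClass ℂ), MeasurableSet T → ∃ φ : Literature.Probability.RandomPlanarGeometry.CurveClass ℂ → ENNReal, Measurable φ ∧ Filter.Eventually (fun γ : Literature.Probability.RandomPlanarGeometry.CurveClass ℂ => Q₂ (γ.stopAt F) T = φ (γ.stopAt F)) (MeasureTheory.ae μ)) → (∀ S T : Set (Literature.Probability.RandomPlanarGeometry.CurveClass ℂ), MeasurableSet S → MeasurableSet T → μ (Literature.Probability.RandomPlanarGeometry.CurveClass.stopAt F ⁻¹' S ∩ Literature.Probability.RandomPlanarGeometry.CurveClass.startFrom F ⁻¹' T) = MeasureTheory.lintegral (μ.restrict (Literature.Probability.RandomPlanarGeometry.CurveClass.stopAt F ⁻¹' S)) (fun γ => Q₁ (γ.stopAt F) T)) → (∀ S T : Set (Literature.Probability.RandomPlanarGeometry.CurveClass ℂ), MeasurableSet S → MeasurableSet T → μ (Literature.Probability.RandomPlanarGeometry.CurveClass.stopAt F ⁻¹' S ∩ Literature.Probability.RandomPlanarGeometry.CurveClass.startFrom F ⁻¹' T) = MeasureTheory.lintegral (μ.restrict (Literature.Probability.RandomPlanarGeometry.CurveClass.stopAt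 F ⁻¹' S)) (fun γ => Q₂ (γ.stopAt F) T)) → Filter.Eventually (fun γ : Literature.Probability.RandomPlanarGeometry.CurveClass ℂ => Q₁ (γ.stopAt F) = Q₂ (γ.stopAt F)) (MeasureTheory.ae μ) := by
  intro μ _ F hF Q₁ Q₂ hQ₁ hQ₂ h₁ h₂
  have hg : Measurable (CurveClass.stopAt F : CurveClass ℂ → CurveClass ℂ) :=
    CurveClass.measurable_stopAt hF
  -- setwise a.e. agreement
  have hae : ∀ T : Set (CurveClass ℂ), MeasurableSet T →
      (fun γ => Q₁ (γ.stopAt F) T) =ᵐ[μ] fun γ => Q₂ (γ.stopAt F) T := by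
    intro T hT
    obtain ⟨φ₁, hφ₁, hae₁⟩ := hQ₁ T hT
    obtain ⟨φ₂, hφ₂, hae₂⟩ := hQ₂ T hT
    refine AEUniqueAEM.ae_eq_of_versions hg hφ₁ hφ₂ hae₁ hae₂ fun S hS => ?_
    rw [← h₁ S T hS hT, ← h₂ S T hS hT]
  -- a.e. finiteness of the total mass
  have hfin : ∀ᵐ γ ∂μ, Q₁ (γ.stopAt F) univ < ∞ := by
    obtain ⟨φ, hφ, haeφ⟩ := hQ₁ univ MeasurableSet.univ
    refine AEUniqueAEM.ae_lt_top_of_version hg hφ haeφ ?_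
    have huniv := h₁ univ univ MeasurableSet.univ MeasurableSet.univ
    rw [Set.preimage_univ, Measure.restrict_univ] at huniv
    rw [← huniv]
    exact measure_ne_top μ _
  exact AEUnique.ae_eq_of_forall_ae_apply_eq (Q₁ := fun γ : CurveClass ℂ => Q₁ (γ.stopAt F))
    (Q₂ := fun γ : CurveClass ℂ => Q₂ (γ.stopAt F)) hfin hae

end Summit.CriticalPhenomena.SAWScalingLimit.Theorems.AxiomsOfLimitKernelClause

end
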